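import Literature.Computability.Complexity.CircuitClasses
import Literature.Computability.Complexity.Nondeterministic
import HarnessLib

/-!
# `C ⊆ C/poly` with empty advice, and `NP ⊆ NP/poly`

Trunk T-CPLX-CORE; cite item `wi-03855` (route ValiantsHypothesis/BoolTransfer, hypothesis of
stmt-0344): the routine inclusion `NP ⊆ polyAdvice NP` (Arora–Barak 2009, Def. 6.16 and the
remark after it), over the tree's `polyAdvice` (`CircuitClasses.lean`) and `NP`
(`Nondeterministic.lean`).

The one-line argument — advice `a n = []`, `L' := {w | (boolUnpair w).1 ∈ L}`, so that
`x ∈ L ↔ boolPair x [] ∈ L'` by `boolUnpair (boolPair x y) = (x, y)` — is PROVED here for every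
class `C` closed under precomposition with the (polynomial-time) first projection of a
`boolPair`-encoded pair (`subset_polyAdvice_of_closed_fst`). What is NOT proved in-tree is that
closure for `NP` (it is `NP`'s closure under Karp reductions, `mem_NP_of_karpReducible`, applied to
the projection, `polyTimeComputable_fst` — both recorded as facts elsewhere but over encoders that
do not compose without `PolyTimeComputable.comp`); it is recorded as the small named fact
`NP_closed_boolUnpair_fst`, from which `NP_subset_polyAdvice_NP` follows as a theorem.

## References

* S. Arora, B. Barak, *Computational Complexity* (2009), Def. 6.16 (`C/poly`, advice), remark;
  Thm. 2.8 / Ex. 2.9 (closure of `NP` under polynomial-time reductions).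
-/

noncomputable section

namespace Literature.Computability.Complexity

/-- **`C ⊆ C/poly` with empty advice**, for every class `C` closed under `L ↦ {w | (boolUnpair w).1 ∈ L}`
(precomposition with the first projection of the pairing): take `L' = {w | (boolUnpair w).1 ∈ L}`,
advice `a n = []`, bound `p = 0`. [Arora–Barak 2009, Def. 6.16 (remark: `P ⊆ P/poly`)] [folklore] -/
theorem subset_polyAdvice_of_closed_fst (C : Set (Language Bool))
    (hC : ∀ L ∈ C, {w | (boolUnpair w).1 ∈ L} ∈ C) : C ⊆ polyAdvice C := by
  intro L hL
  refine ⟨{w | (boolUnpair w).1 ∈ L}, hC L hL, fun _ => [], 0, fun n => by simp, fun x => ?_⟩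
  change x ∈ L ↔ (boolUnpair (boolPair x [])).1 ∈ L
  rw [boolUnpair_boolPair]

/-- NAMED FACT (routine; **Arora–Barak 2009, Thm. 2.8 / Ex. 2.9** — `NP` is closed under
polynomial-time Karp reductions — applied to the polynomial-time first projection of a
`boolPair`-encoded pair, §0.1/§1.2): for `L ∈ NP`, `{w | (boolUnpair w).1 ∈ L} ∈ NP`. (In-tree this
is `mem_NP_of_karpReducible` + `polyTimeComputable_fst`, modulo composition of polynomial-time
machines.) Users take `(h : NP_closed_boolUnpair_fst)`. [Arora–Barak 2009, Thm. 2.8, Ex. 2.9,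
§1.2] [cite: AroraBarak2009, Thm. 2.8 and Ex. 2.9] -/
def NP_closed_boolUnpair_fst : Prop :=
  ∀ L ∈ Nondeterministic.NP, {w | (boolUnpair w).1 ∈ L} ∈ Nondeterministic.NP

/-- **`NP ⊆ NP/poly`** (empty advice), from the closure fact. This is the requested signature
`Literature.CplxCore.NP ⊆ Literature.CplxCore.polyAdvice Literature.CplxCore.NP`. [Arora–Barak 2009, Def. 6.16
(remark)] [folklore] -/
theorem NP_subset_polyAdvice_NP (h : NP_closed_boolUnpair_fst) : Nondeterministic.NP ⊆ polyAdvice Nondeterministic.NP :=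
  subset_polyAdvice_of_closed_fst Nondeterministic.NP h

/-- Likewise `C ⊆ C/poly` for ANY class given its closure under the projection (e.g. `P`,
`PSPACE`). [Arora–Barak 2009, Def. 6.16] [folklore] -/
theorem self_subset_polyAdvice_iff_of_closed (C : Set (Language Bool))
    (hC : ∀ L ∈ C, {w | (boolUnpair w).1 ∈ L} ∈ C) (L : Language Bool) (hL : L ∈ C) :
    L ∈ polyAdvice C :=
  subset_polyAdvice_of_closed_fst C hC hL

end Literature.Computability.Complexity
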